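import Mathlib
import HarnessLib
import Summits.ValiantsHypothesis.ValiantsHypothesis.Theorems.LacunarySymmetroidMatrixDescartesOsculationLawPeelLocalBranch

/-!
# ValiantsHypothesis / LacunarySymmetroid — crux `MatrixDescartes` (stmt-ValiantsHypothesis-18050, V1),
# line `Cruxes/MatrixDescartes/Lines/osculation_law.lean` («osculation-law»), stub `stub_peel` (ALL ranks):
# BRANCHES ARE UNIQUE — GLUING BY LOCAL UNIQUENESS (rank-free; part of piece (α) of NOTE-p7g12-peel-general-r-sizing.md)

Two continuous solutions `b = β(t)`, `b = γ(t)` of `Φ(t, b) = 0` on a compact interval which agree at ONE point agree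
everywhere, provided every point `(t, β t)` is a point of LOCAL UNIQUENESS of the curve (near it the zero set is the
graph of one function) — the conclusion of `OsculationPeel.exists_local_branch` at simple points, hence (by
`…PeelSimpleBranches`) of EVERY curve point of the open quadrant for a hyperbolic family in general position.  The proof
is "real induction" (`IsClosed.Icc_subset_of_forall_mem_nhdsWithin`) to the right, and a reflection `t ↦ −t` for the
left; the relation `R t b` is kept abstract so that the reflection is free.

* `eqOn_Icc_of_localUnique_right` — agreement at the left endpoint propagates over `Icc t₀ t₁`.
* `eqOn_Icc_of_localUnique` — agreement at any point of `Icc t₀ t₁` propagates over the whole interval.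
* **`branch_unique_of_hyperbolic`** — for `Φ` with hyperbolic vertical family, finite osculation set and GP: a continuous POSITIVE
  solution and any continuous solution on `Icc t₀ t₁ ⊆ (0, ∞)` agreeing at one point coincide (the gluing step of the maximal-continuation
  theorem (α)).

Honest framing: a rank-free LEMMA toward the OPEN stub `stub_peel` (all `r`); nothing of the summit is proved; `VP ≠ VNP` is
NOT proved.  No definitions, no named facts.
-/

-- `Summit.ValiantsHypothesis.ValiantsHypothesis.…` is the tree's mandated single-conjunct layout (Sub = Summit).
set_option linter.dupNamespace false

noncomputable section

namespace Summit.ValiantsHypothesis.ValiantsHypothesis.Theorems.LacunarySymmetroidMatrixDescartes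

open Polynomial Set Filter
open MvPolynomial (pderiv)
open scoped BigOperators Topology

namespace OsculationPeel

/-- **Gluing to the right.**  `β, γ` continuous solutions of `R` on `Icc t₀ t₁`, every `(t, β t)` a point of local
uniqueness, `β t₀ = γ t₀` ⇒ `β = γ` on `Icc t₀ t₁`. [folklore] -/
theorem eqOn_Icc_of_localUnique_right {R : ℝ → ℝ → Prop} {β γ : ℝ → ℝ} {t₀ t₁ : ℝ}
    (hβ : ContinuousOn β (Icc t₀ t₁)) (hγ : ContinuousOn γ (Icc t₀ t₁))
    (hRβ : ∀ t ∈ Icc t₀ t₁, R t (β t)) (hRγ : ∀ t ∈ Icc t₀ t₁, R t (γ t))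
    (hU : ∀ t ∈ Icc t₀ t₁, ∃ ψ : ℝ → ℝ, ∀ᶠ v in 𝓝 ((t, β t) : ℝ × ℝ), R v.1 v.2 ↔ ψ v.1 = v.2)
    (h0 : β t₀ = γ t₀) : EqOn β γ (Icc t₀ t₁) := by
  intro t ht
  set s : Set ℝ := {t | β t = γ t} with hs
  have hclosed : IsClosed (s ∩ Icc t₀ t₁) := by
    have h := (hβ.sub hγ).preimage_isClosed_of_isClosed isClosed_Icc (isClosed_singleton (x := (0 : ℝ)))
    have e : Icc t₀ t₁ ∩ (β - γ) ⁻¹' {0} = s ∩ Icc t₀ t₁ := by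
      ext u
      simp only [mem_inter_iff, mem_preimage, mem_singleton_iff, hs, mem_setOf_eq, Pi.sub_apply, sub_eq_zero]
      tauto
    rwa [e] at h
  refine (hclosed.Icc_subset_of_forall_mem_nhdsWithin (by exact h0) ?_) ht
  rintro x ⟨hx, hx0, hx1⟩
  obtain ⟨ψ, hψ⟩ := hU x ⟨hx0, hx1.le⟩
  -- along `𝓝[>] x` both `(u, β u)` and `(u, γ u)` tend to `(x, β x) = (x, γ x)`
  have hIoo : Ioo x t₁ ∈ 𝓝[>] x := Ioo_mem_nhdsGT hx1
  have hβc : Tendsto β (𝓝[>] x) (𝓝 (β x)) := by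
    have h := (hβ x ⟨hx0, hx1.le⟩).mono_left (nhdsWithin_le_of_mem (by
      exact mem_of_superset hIoo fun u hu => ⟨hx0.trans hu.1.le, hu.2.le⟩))
    exact h
  have hγc : Tendsto γ (𝓝[>] x) (𝓝 (β x)) := by
    have h := (hγ x ⟨hx0, hx1.le⟩).mono_left (nhdsWithin_le_of_mem (by
      exact mem_of_superset hIoo fun u hu => ⟨hx0.trans hu.1.le, hu.2.le⟩))
    have hxs : γ x = β x := (show β x = γ x from hx).symm
    rwa [hxs] at h
  have hid : Tendsto (fun u : ℝ => u) (𝓝[>] x) (𝓝 x) := tendsto_id.mono_left nhdsWithin_le_nhds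
  have h1 := (hid.prodMk_nhds hβc).eventually hψ
  have h2 := (hid.prodMk_nhds hγc).eventually hψ
  have hmem : ∀ᶠ u in 𝓝[>] x, u ∈ Icc t₀ t₁ :=
    mem_of_superset hIoo fun u hu => ⟨hx0.trans hu.1.le, hu.2.le⟩
  filter_upwards [h1, h2, hmem] with u hu1 hu2 hu
  show β u = γ u
  rw [← hu1.1 (hRβ u hu), ← hu2.1 (hRγ u hu)]

/-- **Gluing.**  Same, with agreement at ANY point `t* ∈ Icc t₀ t₁` (leftward by the reflection `t ↦ −t`). [folklore] -/
theorem eqOn_Icc_of_localUnique {R : ℝ → ℝ → Prop} {β γ : ℝ → ℝ} {t₀ t₁ tstar : ℝ} (hstar : tstar ∈ Icc t₀ t₁)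
    (hβ : ContinuousOn β (Icc t₀ t₁)) (hγ : ContinuousOn γ (Icc t₀ t₁))
    (hRβ : ∀ t ∈ Icc t₀ t₁, R t (β t)) (hRγ : ∀ t ∈ Icc t₀ t₁, R t (γ t))
    (hU : ∀ t ∈ Icc t₀ t₁, ∃ ψ : ℝ → ℝ, ∀ᶠ v in 𝓝 ((t, β t) : ℝ × ℝ), R v.1 v.2 ↔ ψ v.1 = v.2)
    (h0 : β tstar = γ tstar) : EqOn β γ (Icc t₀ t₁) := by
  intro t ht
  rcases le_total tstar t with hle | hle
  · -- to the right of `t*`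
    have hsub : Icc tstar t₁ ⊆ Icc t₀ t₁ := Icc_subset_Icc hstar.1 le_rfl
    exact eqOn_Icc_of_localUnique_right (hβ.mono hsub) (hγ.mono hsub) (fun u hu => hRβ u (hsub hu))
      (fun u hu => hRγ u (hsub hu)) (fun u hu => hU u (hsub hu)) h0 ⟨hle, ht.2⟩
  · -- to the left of `t*`: reflect
    have hsub : Icc t₀ tstar ⊆ Icc t₀ t₁ := Icc_subset_Icc le_rfl hstar.2
    have hneg : ∀ u, u ∈ Icc (-tstar) (-t₀) → -u ∈ Icc t₀ tstar := fun u hu => ⟨by linarith [hu.2], by linarith [hu.1]⟩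
    have hcn : ContinuousOn (fun u : ℝ => -u) (Icc (-tstar) (-t₀)) := continuous_neg.continuousOn
    have hmaps : MapsTo (fun u : ℝ => -u) (Icc (-tstar) (-t₀)) (Icc t₀ t₁) := fun u hu => hsub (hneg u hu)
    have key := eqOn_Icc_of_localUnique_right (R := fun u b => R (-u) b) (β := fun u => β (-u)) (γ := fun u => γ (-u))
      (t₀ := -tstar) (t₁ := -t₀) (hβ.comp hcn hmaps) (hγ.comp hcn hmaps)
      (fun u hu => hRβ (-u) (hsub (hneg u hu))) (fun u hu => hRγ (-u) (hsub (hneg u hu))) ?_ (by simpa using h0)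
    · have := key (x := -t) ⟨by linarith, by linarith [ht.1]⟩
      simpa using this
    · intro u hu
      obtain ⟨ψ, hψ⟩ := hU (-u) (hsub (hneg u hu))
      refine ⟨fun w => ψ (-w), ?_⟩
      have hc : Tendsto (fun v : ℝ × ℝ => ((-v.1, v.2) : ℝ × ℝ)) (𝓝 ((u, β (-u)) : ℝ × ℝ)) (𝓝 ((-u, β (-u)) : ℝ × ℝ)) :=
        ((continuous_neg.comp continuous_fst).prodMk continuous_snd).tendsto (u, β (-u))
      exact (hc.eventually hψ).mono fun v hv => hv

/-- **Branch uniqueness for hyperbolic families in general position.**  If the vertical family `P t = Φ(t,·)` splits for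
`t > 0`, the osculation set is finite and `∂_bΦ ≠ 0` on it, then a continuous POSITIVE solution `β` of `Φ(t, b) = 0` on an
interval `Icc t₀ t₁` with `t₀ > 0` and any continuous solution `γ` there agreeing with `β` at one point agree on the whole
interval. [folklore] -/
theorem branch_unique_of_hyperbolic (Φ : MvPolynomial (Fin 2) ℝ) (P : ℝ → ℝ[X])
    (hP : ∀ t b, (P t).eval b = MvPolynomial.eval ![t, b] Φ) (hsplit : ∀ t, 0 < t → (P t).Splits)
    (hfin : {p : Fin 2 → ℝ | 0 < p 0 ∧ 0 < p 1 ∧ MvPolynomial.eval p Φ = 0 ∧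
      MvPolynomial.eval p
        (MvPolynomial.X 0 * MvPolynomial.pderiv 0 (MvPolynomial.X 0 * MvPolynomial.pderiv 0 Φ)
            * (MvPolynomial.X 1 * MvPolynomial.pderiv 1 Φ) ^ 2
          - 2 * (MvPolynomial.X 0 * MvPolynomial.pderiv 0 (MvPolynomial.X 1 * MvPolynomial.pderiv 1 Φ))
            * (MvPolynomial.X 0 * MvPolynomial.pderiv 0 Φ) * (MvPolynomial.X 1 * MvPolynomial.pderiv 1 Φ)
          + MvPolynomial.X 1 * MvPolynomial.pderiv 1 (MvPolynomial.X 1 * MvPolynomial.pderiv 1 Φ)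
            * (MvPolynomial.X 0 * MvPolynomial.pderiv 0 Φ) ^ 2) = 0}.Finite)
    (hgp : ∀ p ∈ {p : Fin 2 → ℝ | 0 < p 0 ∧ 0 < p 1 ∧ MvPolynomial.eval p Φ = 0 ∧
      MvPolynomial.eval p
        (MvPolynomial.X 0 * MvPolynomial.pderiv 0 (MvPolynomial.X 0 * MvPolynomial.pderiv 0 Φ)
            * (MvPolynomial.X 1 * MvPolynomial.pderiv 1 Φ) ^ 2
          - 2 * (MvPolynomial.X 0 * MvPolynomial.pderiv 0 (MvPolynomial.X 1 * MvPolynomial.pderiv 1 Φ))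
            * (MvPolynomial.X 0 * MvPolynomial.pderiv 0 Φ) * (MvPolynomial.X 1 * MvPolynomial.pderiv 1 Φ)
          + MvPolynomial.X 1 * MvPolynomial.pderiv 1 (MvPolynomial.X 1 * MvPolynomial.pderiv 1 Φ)
            * (MvPolynomial.X 0 * MvPolynomial.pderiv 0 Φ) ^ 2) = 0},
        MvPolynomial.eval p (MvPolynomial.pderiv 1 Φ) ≠ 0)
    {β γ : ℝ → ℝ} {t₀ t₁ tstar : ℝ} (ht₀ : 0 < t₀) (hstar : tstar ∈ Icc t₀ t₁)
    (hβ : ContinuousOn β (Icc t₀ t₁)) (hγ : ContinuousOn γ (Icc t₀ t₁))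
    (hβpos : ∀ t ∈ Icc t₀ t₁, 0 < β t)
    (hΦβ : ∀ t ∈ Icc t₀ t₁, MvPolynomial.eval ![t, β t] Φ = 0) (hΦγ : ∀ t ∈ Icc t₀ t₁, MvPolynomial.eval ![t, γ t] Φ = 0)
    (h0 : β tstar = γ tstar) : EqOn β γ (Icc t₀ t₁) := by
  refine eqOn_Icc_of_localUnique (R := fun t b => MvPolynomial.eval ![t, b] Φ = 0) hstar hβ hγ hΦβ hΦγ ?_ h0
  intro t ht
  obtain ⟨ψ, -, -, -, hψ⟩ := exists_local_branch_of_hyperbolic Φ P hP hsplit hfin hgp (ht₀.trans_le ht.1) (hβpos t ht)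
    (hΦβ t ht)
  exact ⟨ψ, hψ⟩

end OsculationPeel

end Summit.ValiantsHypothesis.ValiantsHypothesis.Theorems.LacunarySymmetroidMatrixDescartes

end
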